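import Summits.Ventures.Crystal3D.Theorems.StickyWulffConstantCoaxialWallLawPayerPairCount
import HarnessLib

/-!
# Definitions: the pooled word-end multiplicity ROW of lane F (the census object of cf-p1 DECISION (xxxiii))

HONEST FRAMING. Venture `Summits/Ventures/Crystal3D` (cell `crystal3d-full`), crux `CoaxialWallLaw`
(stmt-Ventures-19481, `route-Ventures-StickyWulffConstant`), REGISTERED line `WallLedgerF` (planner cf-p1), open stub
`stub_coaxialTwoSlabAdhesion`.  DEFINITIONS ONLY (the route posits this object: ROUTE §86(3)/(43)/(47); calibration
memo HOME/wall-19481-p2/F-CALIB-g6.md; numerical census of record HOME/cf-lit/fstep1/STEP1-RESULTS.md).  Nothing is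
claimed here; the Props below are HYPOTHESES of the STEP-2 glue (`…EndRowDischarge` consumes the local row) and the
targets of cf-p2's certificate.  F-C1 not moved.

THE OBJECTS, read off the export theorems `word_endPairs_multiExcl` / `wordNet_twin_endPairs_multi` /
`wordNet_trans_endPairs_plane_multi` (the exported set `T` = REACHED ENDS of the word automaton as (end ball,
predecessor ball) pairs):
* `WordVersion` — `v1` (the landed automaton: FULL / twin-dozen CROSS / GLIDE) or `v2` (adds the NARROW straight move:
  target and the two back-face balls of a positive triple occupied; F-NEXT-SPEC §S2, `∃ m` form);
* `IsMenuNormal`, `IsFull`, `IsTwinReading`, `IsMoving v` — the mover predicates at a state `(b; G, d)`, verbatim the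
  exported clauses; `IsEndMove v X G d q b` — `q` moves onto `b` in class `(G, d)` AND the target state (frame `G` for
  straight/glide, `G ∘ M_m` for a cross along the reading normal `m`; direction `b − q`) is NOT moving;
  `HasTwoPayers` — the exported two-payer clause;
* `WFChain r κ` — well-formed chains of model crossing normals for the root `r` (`hWF0`/`hWFc` with `u r κ = (−1)^{|κ|} r`);
  `PlateSystem` = a base frame `G₀` and a root set `RT`; `PlateSystem.Fw κ` = the chain frame; `PlateSystem.Adm G d` —
  `(G, d)` is the class datum of some well-formed chain of some root;
* `IsEndPair v X S₁ S₂ b q`, `endMult`, `pooledDef`, and the LOCAL ROW `LocalEndRow v sF S₁ S₂` (deficiency-proportional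
  discharge at radius `1`: at every payer `z`, `Σ_{end balls b within 1 of z} endMult b / pooledDef b ≤ sF`);
* the three census facts BY NAME: `EndRowTwin v sF` (bottom frame `L` with rising in-plane roots, top frame the basal
  twin of `L` with falling in-plane roots), `EndRowTrans v sF` (same frame, opposite in-plane roots: fault-coset /
  plane-coset translation pairs), `EndRowTrans6 v sF` (same frame, all six rising / falling roots: 3-adically generic
  translation pairs).  Thresholds (Σ(12−deg) currency): `sF ≤ 2√6` gives `c₁ = ½` for the first two, `sF ≤ 4√3` for
  the third; the STEP-1 numerics of record: v2 root-blind 3.60, v1 chain-consistent 3.40 on 1332 structures.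

WHAT THIS IS NOT: not a theorem; not the certificate; not the glue.  F-C1 not moved.
-/

noncomputable section

namespace Summit.Ventures.Crystal3D.Theorems

open Summit.Ventures.Crystal3D Finset
open scoped InnerProductSpace

/-- The automaton version: `v1` (as landed) or `v2` (narrow straight continuation added). -/
inductive WordVersion
  /-- FULL / CROSS / GLIDE moves only (19481-p1 g6). -/
  | v1
  /-- `v1` plus the NARROW straight move (target and back-face pair occupied). -/
  | v2
  deriving DecidableEq

section Movers

variable (X : Finset (EuclideanSpace ℝ (Fin 3)))

/-- `m` is a `{111}` MENU NORMAL of the frame `G`: unit, every slot image in-plane or at `±√(2/3)`. -/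
def IsMenuNormal (G : EuclideanSpace ℝ (Fin 3) ≃ₗᵢ[ℝ] EuclideanSpace ℝ (Fin 3)) (m : EuclideanSpace ℝ (Fin 3)) : Prop :=
  ‖m‖ = 1 ∧ ∀ w ∈ fccSlots, ⟪G w, m⟫_ℝ = 0 ∨ ⟪G w, m⟫_ℝ = Real.sqrt (2 / 3) ∨ ⟪G w, m⟫_ℝ = -Real.sqrt (2 / 3)

/-- FULL reading: the whole `G`-shell of `b` is occupied. -/
def IsFull (G : EuclideanSpace ℝ (Fin 3) ≃ₗᵢ[ℝ] EuclideanSpace ℝ (Fin 3)) (b : EuclideanSpace ℝ (Fin 3)) : Prop :=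
  ∀ w ∈ fccSlots, b + G w ∈ X

/-- TWIN-DOZEN reading of `(G, m)` at `b` (own closed lower half-dozen and the three mirror balls occupied, the three
far slots empty) — verbatim the exported clause. -/
def IsTwinReading (G : EuclideanSpace ℝ (Fin 3) ≃ₗᵢ[ℝ] EuclideanSpace ℝ (Fin 3)) (m b : EuclideanSpace ℝ (Fin 3)) :
    Prop :=
  IsMenuNormal G m ∧
    (∀ w ∈ fccSlots, ⟪G w, m⟫_ℝ ≤ 0 → b + G w ∈ X) ∧
    (∀ w ∈ fccSlots, ⟪G w, m⟫_ℝ < 0 → b + (G w - (2 * ⟪G w, m⟫_ℝ) • m) ∈ X) ∧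
    (∀ w ∈ fccSlots, 0 < ⟪G w, m⟫_ℝ → b + G w ∉ X)

/-- NARROW straight reading (version `v2` only): the target `b + d` and, for a menu normal `m` crossing `d` upward,
the whole positive-`m` triple of `b` are occupied. -/
def IsNarrow (G : EuclideanSpace ℝ (Fin 3) ≃ₗᵢ[ℝ] EuclideanSpace ℝ (Fin 3)) (d b : EuclideanSpace ℝ (Fin 3)) : Prop :=
  b + d ∈ X ∧ ∃ m, IsMenuNormal G m ∧ ⟪d, m⟫_ℝ = Real.sqrt (2 / 3) ∧ ∀ w ∈ fccSlots, 0 < ⟪G w, m⟫_ℝ → b + G w ∈ X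

/-- The state `(b; G, d)` is MOVING under version `v`. -/
def IsMoving (v : WordVersion) (G : EuclideanSpace ℝ (Fin 3) ≃ₗᵢ[ℝ] EuclideanSpace ℝ (Fin 3))
    (d b : EuclideanSpace ℝ (Fin 3)) : Prop :=
  IsFull X G b ∨
    (∃ m, IsTwinReading X G m b ∧ (⟪d, m⟫_ℝ = Real.sqrt (2 / 3) ∨ ⟪d, m⟫_ℝ = 0)) ∨
    (v = WordVersion.v2 ∧ IsNarrow X G d b)

/-- `q` MOVES ONTO `b` in the class `(G, d)` under version `v`, and the TARGET state is not moving: a straight move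
(FULL, or NARROW under `v2`) or a GLIDE keeps the class and `b = q + d`; a CROSS along the reading normal `m` lands in
the mirrored class `(G ∘ M_m, M_m(−d))` at `b = q − M_m d`; in every case the arriving direction is `b − q`. -/
def IsEndMove (v : WordVersion) (G : EuclideanSpace ℝ (Fin 3) ≃ₗᵢ[ℝ] EuclideanSpace ℝ (Fin 3))
    (d q b : EuclideanSpace ℝ (Fin 3)) : Prop :=
  ((IsFull X G q ∨ (v = WordVersion.v2 ∧ IsNarrow X G d q) ∨ (∃ m, IsTwinReading X G m q ∧ ⟪d, m⟫_ℝ = 0)) ∧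
      b = q + d ∧ ¬ IsMoving X v G d b) ∨
  (∃ m, IsTwinReading X G m q ∧ ⟪d, m⟫_ℝ = Real.sqrt (2 / 3) ∧ b = q - (d - (2 * ⟪d, m⟫_ℝ) • m) ∧
    ¬ IsMoving X v (G.trans (ℝ ∙ m)ᗮ.reflection) (b - q) b)

/-- The exported TWO-PAYER clause at the end ball `b`. -/
def HasTwoPayers (b : EuclideanSpace ℝ (Fin 3)) : Prop :=
  (X.filter fun q => dist b q = 1).card ≤ 11 ∨
    ∃ z₁ ∈ X, ∃ z₂ ∈ X, z₁ ≠ z₂ ∧ dist b z₁ = 1 ∧ dist b z₂ = 1 ∧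
      (X.filter fun q => dist z₁ q = 1).card ≤ 11 ∧ (X.filter fun q => dist z₂ q = 1).card ≤ 11

end Movers

/-- Well-formed chains of MODEL crossing normals for the root `r` (verbatim `hWF0`/`hWFc` of `word_endPairs_multiExcl`
with `u r κ = (−1)^{|κ|} • r`): each letter is a unit model menu normal crossing the current direction upward, and no
letter cancels its predecessor. -/
def WFChain (r : EuclideanSpace ℝ (Fin 3)) : List (EuclideanSpace ℝ (Fin 3)) → Prop
  | [] => True
  | μ :: κ => WFChain r κ ∧ ‖μ‖ = 1 ∧
      (∀ w ∈ fccSlots, ⟪w, μ⟫_ℝ = 0 ∨ ⟪w, μ⟫_ℝ = Real.sqrt (2 / 3) ∨ ⟪w, μ⟫_ℝ = -Real.sqrt (2 / 3)) ∧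
      ⟪((-1 : ℝ) ^ κ.length) • r, μ⟫_ℝ = Real.sqrt (2 / 3) ∧ ∀ μ' κ', κ = μ' :: κ' → μ' ≠ -μ

/-- A PLATE WORD SYSTEM: the plate's frame `G₀` (a map) and its root set `RT ⊆ fccSlots` (model slots). -/
structure PlateSystem where
  /-- the plate's frame -/
  G₀ : EuclideanSpace ℝ (Fin 3) ≃ₗᵢ[ℝ] EuclideanSpace ℝ (Fin 3)
  /-- the root slots (model coordinates) -/
  RT : Finset (EuclideanSpace ℝ (Fin 3))

namespace PlateSystem

/-- The frame of the class `κ`: `Fw (μ :: κ) = Fw κ ∘ M_μ` (model letters), `Fw [] = G₀`. -/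
def Fw (S : PlateSystem) : List (EuclideanSpace ℝ (Fin 3)) → (EuclideanSpace ℝ (Fin 3) ≃ₗᵢ[ℝ] EuclideanSpace ℝ (Fin 3))
  | [] => S.G₀
  | μ :: κ => ((ℝ ∙ μ)ᗮ.reflection).trans (S.Fw κ)

/-- `(G, d)` is an ADMISSIBLE class datum of the system: the frame and direction of a well-formed chain of a root. -/
def Adm (S : PlateSystem) (G : EuclideanSpace ℝ (Fin 3) ≃ₗᵢ[ℝ] EuclideanSpace ℝ (Fin 3))
    (d : EuclideanSpace ℝ (Fin 3)) : Prop :=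
  ∃ r ∈ S.RT, ∃ κ, WFChain r κ ∧ G = S.Fw κ ∧ d = S.Fw κ (((-1 : ℝ) ^ κ.length) • r)

end PlateSystem

section Row

variable (X : Finset (EuclideanSpace ℝ (Fin 3)))

/-- END PAIR `(b, q)` of the two-plate word net `(S₁, S₂)` under version `v`: some admissible class of one of the two
plates makes `q` an end-move onto `b`, and `b` has two payers.  Every pair of the exported sets `T` (with the
non-moving clause of the `…Nm` exports) is an end pair in this sense. -/
def IsEndPair (v : WordVersion) (S₁ S₂ : PlateSystem) (b q : EuclideanSpace ℝ (Fin 3)) : Prop :=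
  q ∈ X ∧ b ∈ X ∧ HasTwoPayers X b ∧ ∃ G d, (S₁.Adm G d ∨ S₂.Adm G d) ∧ IsEndMove X v G d q b

open scoped Classical in
/-- END MULTIPLICITY of the ball `b`: the number of predecessor balls `q` with `(b, q)` an end pair. -/
def endMult (v : WordVersion) (S₁ S₂ : PlateSystem) (b : EuclideanSpace ℝ (Fin 3)) : ℕ :=
  (X.filter fun q => IsEndPair X v S₁ S₂ b q).card

/-- POOLED DEFICIENCY around `b`: total deficiency `12 − deg` of the payers (`deg ≤ 11`) within distance `≤ 1` of `b`,
`b` included (`≥ 1` at an end ball by the two-payer clause). -/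
def pooledDef (b : EuclideanSpace ℝ (Fin 3)) : ℝ :=
  ∑ z ∈ X.filter (fun z => dist b z ≤ 1 ∧ (X.filter fun q => dist z q = 1).card ≤ 11),
    ((12 : ℝ) - ((X.filter fun q => dist z q = 1).card : ℝ))

end Row

open scoped Classical in
/-- **THE LOCAL ROW** for the plate systems `(S₁, S₂)` with constant `sF`: for every finite `1`-separated configuration
and every payer `z`, the end balls within distance `1` of `z` load it by at most `sF` per unit of their pooled
deficiency.  `…EndRowDischarge.card_endPairs_le_of_localRow` turns it into `#T ≤ sF · Σ_window (12 − deg)`. -/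
def LocalEndRow (v : WordVersion) (sF : ℝ) (S₁ S₂ : PlateSystem) : Prop :=
  ∀ (X : Finset (EuclideanSpace ℝ (Fin 3))), (∀ p ∈ X, ∀ q ∈ X, p ≠ q → 1 ≤ dist p q) →
  ∀ z ∈ X, (X.filter fun q => dist z q = 1).card ≤ 11 →
    ∑ b ∈ X.filter (fun b => dist z b ≤ 1 ∧ 0 < endMult X v S₁ S₂ b),
      (endMult X v S₁ S₂ b : ℝ) / pooledDef X b ≤ sF

/-- In-plane model slots whose image under `G` RISES (`s = 1`) or FALLS (`s = −1`). -/
def inPlaneRoots (G : EuclideanSpace ℝ (Fin 3) ≃ₗᵢ[ℝ] EuclideanSpace ℝ (Fin 3)) (s : ℝ) :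
    Finset (EuclideanSpace ℝ (Fin 3)) :=
  fccSlots.filter fun r => r 2 = 0 ∧ 0 < s * (G r) 2

/-- All model slots whose image under `G` RISES (`s = 1`) or FALLS (`s = −1`). -/
def allRoots (G : EuclideanSpace ℝ (Fin 3) ≃ₗᵢ[ℝ] EuclideanSpace ℝ (Fin 3)) (s : ℝ) :
    Finset (EuclideanSpace ℝ (Fin 3)) :=
  fccSlots.filter fun r => 0 < s * (G r) 2

/-- **CENSUS FACT (twins).**  For every frame `L`: bottom plate `L` with rising in-plane roots, top plate the basal
twin `M_{e₃} ∘ L` with falling in-plane roots, the local row holds with constant `sF`. -/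
def EndRowTwin (v : WordVersion) (sF : ℝ) : Prop :=
  ∀ L : EuclideanSpace ℝ (Fin 3) ≃ₗᵢ[ℝ] EuclideanSpace ℝ (Fin 3),
    LocalEndRow v sF ⟨L, inPlaneRoots L 1⟩
      ⟨((ℝ ∙ EuclideanSpace.single (2 : Fin 3) (1 : ℝ))ᗮ.reflection).trans L,
        inPlaneRoots (((ℝ ∙ EuclideanSpace.single (2 : Fin 3) (1 : ℝ))ᗮ.reflection).trans L) (-1)⟩

/-- **CENSUS FACT (translation pairs, in-plane roots).**  For every frame `L`: both plates in the frame `L`, rising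
in-plane roots below, falling in-plane roots above. -/
def EndRowTrans (v : WordVersion) (sF : ℝ) : Prop :=
  ∀ L : EuclideanSpace ℝ (Fin 3) ≃ₗᵢ[ℝ] EuclideanSpace ℝ (Fin 3),
    LocalEndRow v sF ⟨L, inPlaneRoots L 1⟩ ⟨L, inPlaneRoots L (-1)⟩

/-- **CENSUS FACT (translation pairs, all rising roots).**  For every frame `L`: both plates in the frame `L`, all six
rising roots below, all six falling roots above (the 3-adically generic class). -/
def EndRowTrans6 (v : WordVersion) (sF : ℝ) : Prop :=
  ∀ L : EuclideanSpace ℝ (Fin 3) ≃ₗᵢ[ℝ] EuclideanSpace ℝ (Fin 3),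
    LocalEndRow v sF ⟨L, allRoots L 1⟩ ⟨L, allRoots L (-1)⟩

/-- **CENSUS FACT (twins, half-turn form)** — the form the STEP-2 glue consumes (`coaxialWallLaw_of_rows`,
`…PayerUnionRow`): for every frame `L`, bottom plate `L` with rising in-plane roots, top plate `L ∘ H` with falling
in-plane roots, where `H = (ℝ ∙ e₃).reflection` is the HALF-TURN about `e₃` in model coordinates (the frame family
`F true = H.trans L` of `…PayerTwinCellExportNm`; it differs from `EndRowTwin`'s plane mirror by `−1` on the top frame). -/
def EndRowTwinHalfTurn (v : WordVersion) (sF : ℝ) : Prop :=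
  ∀ L : EuclideanSpace ℝ (Fin 3) ≃ₗᵢ[ℝ] EuclideanSpace ℝ (Fin 3),
    LocalEndRow v sF ⟨L, inPlaneRoots L 1⟩
      ⟨((ℝ ∙ EuclideanSpace.single (2 : Fin 3) (1 : ℝ)).reflection).trans L,
        inPlaneRoots (((ℝ ∙ EuclideanSpace.single (2 : Fin 3) (1 : ℝ)).reflection).trans L) (-1)⟩

end Summit.Ventures.Crystal3D.Theorems

end
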